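import Literature.Combinatorics.Sahi2008.Marginals
import Literature.Probability.LatticeModels.IsingFKG
import Summits.CriticalPhenomena.PercolationContinuityZ3.Theorems.PercNearOneGluingNoHeavyLowerTailSahiCubeThreeAllOrdersBirkhoff
import Summits.CriticalPhenomena.PercolationContinuityZ3.Theorems.PercNearOneGluingNoHeavyLowerTailSahiSettledClass

/-!
# Sahi's `C_n` for observables of at most three coordinates of an ARBITRARY FKG measure, and the
# single-site `C₃` of the finite-volume Ising ferromagnet

Companion of `SahiConjecture*.lean` (cell `prim-sahi`, typer; `--supports stmt-CriticalPhenomena-4575`).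
Theorems only (no definitions, no named facts, no sorries).

Sahi's conjecture `C_n` (`SahiConjecture n`) is open for every `n ≥ 3`, but the SETTLED lattices of this
directory — `{0,1}³` and every finite distributive lattice with `≤ 3` join-irreducibles
(`SahiCubeAllOrders.sahiPositive_cube_three`, `…sahiPositive_of_card_supIrred_le_three`, seat P1), products
of two finite chains (`SahiTwoDim.sahiPositive_of_isFKGMeasure_prod`) — combine with the finite
Karlin–Rinott marginal theorem (`Literature.Combinatorics.Sahi2008.IsFKGMeasure.pushWeight_latticeHom`,
`sahiE_comp_nonneg_of_forall_isFKGMeasure`, `Marginals.lean`) to give UNCONDITIONAL instances of `C_n`,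
EVERY order `n`, for EVERY FKG probability weight `μ` on ANY finite distributive lattice, restricted to
families of observables that factor through a lattice homomorphism into a settled lattice:

* `sahiE_comp_nonneg_of_latticeHom_set` / `…_supIrred_le_three` / `…_prod` — the three transfer forms;
* `sahiE_nonneg_of_threeCoordinates` — on `{0,1}^ι` (`ι → Bool`), any FKG weight, any `n`: every family of
  nonnegative observables depending monotonically on at most THREE FIXED COORDINATES has `E_n ≥ 0`;
  `sahiE_nonneg_of_twoCoordinates_chain` — on `α^ι`, `α` a finite chain: TWO fixed coordinates, any `n`.

SCOPE (so nobody over-reads it): a lattice hom into `2^X` reads `|X|` Birkhoff coordinates, so these are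
statements about observables of `≤ 3` fixed sites/edges; they do not reach connectivity events (the E3GRP /
one-cut instances of the crux depend on all edges).

ISING.  The finite-volume Gibbs weight of the tree's Ising ferromagnet
(`Literature.Probability.LatticeModels.isingWeight`, couplings `β ≥ 0`, ANY field `h ∈ ℝ`, ANY boundary
condition) is log-supermodular on the distributive lattice `{−1,+1}^Λ` (`isingWeight_lattice_condition`,
Friedli–Velenik (3.53)), hence its normalisation is an FKG probability weight
(`isFKGMeasure_isingGibbsWeight`) whose expectation functional is `isingExpect`
(`ex_isingGibbsWeight_comp_glue`).  Consequently:
* `ising_sahiE_threeSites_nonneg` — for any three sites `x, y, z` and EVERY `n`, every family of nonnegative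
  functions of the sub-configuration `(σ_x, σ_y, σ_z)`, nondecreasing in each spin, has `E_n ≥ 0`;
* `isingExpect_sahiC3_threeSites` — the case `n = 3` with the three up-spin indicators `n_u = (1+σ_u)/2`,
  written in spin correlations:
  `0 ≤ 2⟨σ_xσ_yσ_z⟩ + ⟨σ_xσ_y⟩ + ⟨σ_xσ_z⟩ + ⟨σ_yσ_z⟩ + ⟨σ_x⟩⟨σ_y⟩⟨σ_z⟩
       − ⟨σ_x⟩⟨σ_yσ_z⟩ − ⟨σ_y⟩⟨σ_xσ_z⟩ − ⟨σ_z⟩⟨σ_xσ_y⟩ − ⟨σ_x⟩⟨σ_y⟩ − ⟨σ_x⟩⟨σ_z⟩ − ⟨σ_y⟩⟨σ_z⟩`,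
  i.e. `−U₃(x,y,z) ≤ ½ Σ_cyc (1 + ⟨σ_x⟩)⟨σ_y;σ_z⟩` (`8·E₃(n_x,n_y,n_z) = 2U₃ + Σ_cyc (1+m_x)⟨σ_y;σ_z⟩`): a LOWER
  bound on the third Ursell function, the direction complementary to GHS (`isingExpect_ghs`: `U₃ ≤ 0` for
  `h ≥ 0`, free/`+` b.c.), valid for every sign of `h` and every boundary condition.  (The printed Lebowitz
  `t`-inequality, Glimm–Jaffe Cor. 4.3.2, gives `U₃ ≥ −2(m_y⟨σ_x;σ_z⟩ + m_z⟨σ_x;σ_y⟩)` instead; the two lower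
  bounds are incomparable.)
-/

noncomputable section

namespace Summit.CriticalPhenomena.PercolationContinuityZ3.Theorems.SahiThreeCoordinates

open Finset Literature.Combinatorics.Sahi2008

/-! ### Transfer through a lattice homomorphism into a settled lattice -/

section Transfer

variable {β : Type*} [Fintype β] [DistribLattice β]

/-- **`C_n` through `2^X`, `|X| ≤ 3`.**  For every FKG probability weight `μ` on a finite distributive lattice,
every lattice homomorphism `G : β → 2^X` with `|X| ≤ 3`, every `n` and all nonnegative monotone
`f₀,…,f_{n−1} : 2^X → ℝ`: `E_n^μ(f₀ ∘ G,…,f_{n−1} ∘ G) ≥ 0` (Karlin–Rinott marginal + P1's `sahiThreePointLattice`). -/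
theorem sahiE_comp_nonneg_of_latticeHom_set {μ : β → ℝ} (hμ : IsFKGMeasure μ) {X : Type} [Fintype X]
    (hX : Fintype.card X ≤ 3) (G : LatticeHom β (Set X)) (n : ℕ) (f : Fin n → Set X → ℝ)
    (hf0 : ∀ i c, 0 ≤ f i c) (hmono : ∀ i, Monotone (f i)) : 0 ≤ sahiE μ n fun i => f i ∘ G :=
  sahiE_comp_nonneg_of_forall_isFKGMeasure hμ G
    (fun ν hν => SahiCubeAllOrders.sahiThreePointLattice X hX ν hν n) f hf0 hmono

/-- **`C_n` through any finite distributive lattice with at most three join-irreducibles** (P1's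
`sahiPositive_of_card_supIrred_le_three`). -/
theorem sahiE_comp_nonneg_of_latticeHom_supIrred_le_three {μ : β → ℝ} (hμ : IsFKGMeasure μ)
    {γ : Type*} [Fintype γ] [DistribLattice γ] [DecidableEq γ] (h3 : Nat.card {j : γ // SupIrred j} ≤ 3)
    (G : LatticeHom β γ) (n : ℕ) (f : Fin n → γ → ℝ) (hf0 : ∀ i c, 0 ≤ f i c)
    (hmono : ∀ i, Monotone (f i)) : 0 ≤ sahiE μ n fun i => f i ∘ G :=
  sahiE_comp_nonneg_of_forall_isFKGMeasure hμ G
    (fun _ hν => SahiCubeAllOrders.sahiPositive_of_card_supIrred_le_three h3 hν n) f hf0 hmono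

/-- **`C_n` through a product of two finite chains** (P1's `SahiTwoDim.sahiPositive_of_isFKGMeasure_prod`, the
two-dimensional case of Lieb–Sahi's Conjecture 1.1 for all FKG weights). -/
theorem sahiE_comp_nonneg_of_latticeHom_prod {μ : β → ℝ} (hμ : IsFKGMeasure μ) {α₁ α₂ : Type*}
    [LinearOrder α₁] [Fintype α₁] [LinearOrder α₂] [Fintype α₂] (G : LatticeHom β (α₁ × α₂)) (n : ℕ)
    (f : Fin n → α₁ × α₂ → ℝ) (hf0 : ∀ i c, 0 ≤ f i c) (hmono : ∀ i, Monotone (f i)) :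
    0 ≤ sahiE μ n fun i => f i ∘ G :=
  sahiE_comp_nonneg_of_forall_isFKGMeasure hμ G
    (fun _ hν => SahiTwoDim.sahiPositive_of_isFKGMeasure_prod hν n) f hf0 hmono

end Transfer

/-! ### Observables of at most three fixed coordinates -/

section Coordinates

variable {ι : Type*} [Fintype ι] [DecidableEq ι]

/-- **Three coordinates of `{0,1}^ι`, any FKG weight, any order.**  For every FKG probability weight `μ` on
`ι → Bool`, every `e : Fin 3 → ι` (three coordinates, repetitions allowed), every `n` and all nonnegative
monotone `g₀,…,g_{n−1} : (Fin 3 → Bool) → ℝ`, the observables `ω ↦ gᵢ (ω ∘ e)` satisfy `E_n ≥ 0`. -/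
theorem sahiE_nonneg_of_threeCoordinates {μ : (ι → Bool) → ℝ} (hμ : IsFKGMeasure μ) (e : Fin 3 → ι)
    (n : ℕ) (g : Fin n → (Fin 3 → Bool) → ℝ) (hg0 : ∀ i y, 0 ≤ g i y) (hmono : ∀ i, Monotone (g i)) :
    0 ≤ sahiE μ n fun i ω => g i (ω ∘ e) :=
  sahiE_comp_nonneg_of_forall_isFKGMeasure hμ
    { toFun := fun ω : ι → Bool => ω ∘ e, map_sup' := fun _ _ => rfl, map_inf' := fun _ _ => rfl }
    (fun _ hν => SahiCubeAllOrders.sahiPositive_cube_three hν n) g hg0 hmono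

/-- **Two coordinates of `α^ι`, `α` a finite chain, any FKG weight, any order.**  For every FKG probability
weight `μ` on `ι → α`, any two coordinates `a, b : ι`, every `n` and all nonnegative monotone
`g₀,…,g_{n−1} : α × α → ℝ`, the observables `ω ↦ gᵢ (ω a, ω b)` satisfy `E_n ≥ 0`. -/
theorem sahiE_nonneg_of_twoCoordinates_chain {α : Type*} [LinearOrder α] [Fintype α]
    {μ : (ι → α) → ℝ} (hμ : IsFKGMeasure μ) (a b : ι) (n : ℕ) (g : Fin n → α × α → ℝ)
    (hg0 : ∀ i y, 0 ≤ g i y) (hmono : ∀ i, Monotone (g i)) :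
    0 ≤ sahiE μ n fun i ω => g i (ω a, ω b) :=
  sahiE_comp_nonneg_of_forall_isFKGMeasure hμ
    { toFun := fun ω : ι → α => (ω a, ω b), map_sup' := fun _ _ => rfl, map_inf' := fun _ _ => rfl }
    (fun _ hν => SahiTwoDim.sahiPositive_of_isFKGMeasure_prod hν n) g hg0 hmono

end Coordinates

/-! ### The finite-volume Ising ferromagnet -/

section Ising

open MeasureTheory Literature.Probability.LatticeModels

variable {V : Type*} (Gr : SimpleGraph V) [DecidableEq V] [Gr.LocallyFinite]

/-- **The normalised Ising Gibbs weight is an FKG probability weight** on `{−1,+1}^Λ` (`β ≥ 0`, any field,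
any boundary condition): positivity, total mass one, and the lattice condition `isingWeight_lattice_condition`. -/
theorem isFKGMeasure_isingGibbsWeight (Λ : Finset V) {β : ℝ} (hβ : 0 ≤ β) (h : ℝ) (bc : BoundaryCondition V) :
    IsFKGMeasure fun τ : Λ → ℤˣ => isingWeight Gr Λ β h bc τ / isingPartitionFunction Gr Λ β h bc := by
  have hZ := isingPartitionFunction_pos Gr Λ β h bc
  refine ⟨fun τ => div_nonneg (isingWeight_pos Gr Λ β h bc τ).le hZ.le, ?_, fun a b => ?_⟩
  · rw [← Finset.sum_div, div_eq_one_iff_eq hZ.ne']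
    rfl
  · rw [div_mul_div_comm, div_mul_div_comm]
    exact div_le_div_of_nonneg_right (isingWeight_lattice_condition Gr Λ hβ h bc a b)
      (mul_nonneg hZ.le hZ.le)

/-- **Expectations**: for a measurable observable `f`, `E^{μ_Λ}(f ∘ glue) = ⟨f⟩_{Λ;β,h}^{bc}`. -/
theorem ex_isingGibbsWeight_comp_glue (Λ : Finset V) (β h : ℝ) (bc : BoundaryCondition V)
    {f : SpinConfig V → ℝ} (hf : Measurable f) :
    ex (fun τ : Λ → ℤˣ => isingWeight Gr Λ β h bc τ / isingPartitionFunction Gr Λ β h bc)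
        (fun τ => f (glue Λ τ bc)) = isingExpect Gr Λ β h bc f := by
  rw [isingExpect_eq_sum_div Gr Λ h bc β hf, ex, Finset.sum_div]
  exact Finset.sum_congr rfl fun τ _ => by ring

/-- In `ℤˣ = {−1, 1}` (`−1 < 1`): `x ⊔ y = 1 ↔ x = 1 ∨ y = 1`. -/
theorem units_sup_eq_one_iff (x y : ℤˣ) : x ⊔ y = 1 ↔ x = 1 ∨ y = 1 := by
  revert x y
  decide

/-- In `ℤˣ = {−1, 1}` (`−1 < 1`): `x ⊓ y = 1 ↔ x = 1 ∧ y = 1`. -/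
theorem units_inf_eq_one_iff (x y : ℤˣ) : x ⊓ y = 1 ↔ x = 1 ∧ y = 1 := by
  revert x y
  decide

/-- The up-spin reading `{−1,+1}³ → {0,1}³`, `y ↦ (y_a = 1)_a`, is injective and preserves `⊓`, `⊔`; hence
(P1's `sahiPositive_cube_three` + `SahiSettledClass.sahiPositive_of_latticeEmbedding`) every FKG probability
weight on `{−1,+1}³` is Sahi-positive of every order. -/
theorem sahiPositive_spinCube_three {ν : (Fin 3 → ℤˣ) → ℝ} (hν : IsFKGMeasure ν) (n : ℕ) :
    SahiPositive ν n := by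
  refine SahiSettledClass.sahiPositive_of_latticeEmbedding (L := Fin 3 → ℤˣ) (P := Fin 3 → Bool)
    (fun y a => decide (y a = 1)) ?_ ?_ ?_ (fun _ hρ => SahiCubeAllOrders.sahiPositive_cube_three hρ) hν n
  · intro y y' hyy'
    funext a
    have ha := congrFun hyy' a
    simp only [decide_eq_decide] at ha
    rcases Int.units_eq_one_or (y a) with h1 | h1 <;> rcases Int.units_eq_one_or (y' a) with h2 | h2
    · rw [h1, h2]
    · exact absurd (ha.1 h1) (by rw [h2]; decide)
    · exact absurd (ha.2 h2) (by rw [h1]; decide)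
    · rw [h1, h2]
  · intro y y'
    funext a
    simp only [Pi.inf_apply]
    rw [show (decide (y a = 1) ⊓ decide (y' a = 1)) = (decide (y a = 1) && decide (y' a = 1)) from rfl,
      ← Bool.decide_and, decide_eq_decide, units_inf_eq_one_iff]
  · intro y y'
    funext a
    simp only [Pi.sup_apply]
    rw [show (decide (y a = 1) ⊔ decide (y' a = 1)) = (decide (y a = 1) || decide (y' a = 1)) from rfl,
      ← Bool.decide_or, decide_eq_decide, units_sup_eq_one_iff]

/-- **Ising, three sites, every order.**  For the finite-volume Ising ferromagnet (`β ≥ 0`, any field `h`, any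
boundary condition `bc`, any finite `Λ`), any sites `v₀, v₁, v₂ : V` (repetitions and sites outside `Λ`
allowed — those spins are frozen by `bc`), every `n` and all nonnegative functions `g₀,…,g_{n−1}` of the
sub-configuration `(σ_{v₀}, σ_{v₁}, σ_{v₂}) ∈ {−1,+1}³` that are nondecreasing in each spin:
`E_n^{μ_Λ}(g₀(σ_v), …, g_{n−1}(σ_v)) ≥ 0` — Sahi's `C_n` for these observables, unconditionally. -/
theorem ising_sahiE_threeSites_nonneg (Λ : Finset V) {β : ℝ} (hβ : 0 ≤ β) (h : ℝ) (bc : BoundaryCondition V)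
    (v : Fin 3 → V) (n : ℕ) (g : Fin n → (Fin 3 → ℤˣ) → ℝ) (hg0 : ∀ i y, 0 ≤ g i y)
    (hmono : ∀ i, Monotone (g i)) :
    0 ≤ sahiE (fun τ : Λ → ℤˣ => isingWeight Gr Λ β h bc τ / isingPartitionFunction Gr Λ β h bc) n
      fun i τ => g i fun a => glue Λ τ bc (v a) :=
  sahiE_comp_nonneg_of_forall_isFKGMeasure (isFKGMeasure_isingGibbsWeight Gr Λ hβ h bc)
    { toFun := fun (τ : Λ → ℤˣ) (a : Fin 3) => glue Λ τ bc (v a)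
      map_sup' := fun τ τ' => by funext a; simp only [glue_sup, Pi.sup_apply]
      map_inf' := fun τ τ' => by funext a; simp only [glue_inf, Pi.inf_apply] }
    (fun _ hν => sahiPositive_spinCube_three hν n) g hg0 hmono

/-- The spin at a site as a function of the sub-configuration: `σ_{v a} = y_a` read in `ℝ`; with
`(1 + y_a)/2 ∈ {0,1}` nonnegative and nondecreasing in `y`. -/
theorem half_one_add_units_nonneg (u : ℤˣ) : 0 ≤ (1 + ((u : ℤ) : ℝ)) / 2 := by
  rcases Int.units_eq_one_or u with h1 | h1 <;> simp [h1]

/-- Monotonicity of `y ↦ (1 + y_a)/2` on `{−1,+1}³`. -/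
theorem monotone_half_one_add_apply (a : Fin 3) :
    Monotone fun y : Fin 3 → ℤˣ => (1 + ((y a : ℤ) : ℝ)) / 2 := by
  intro y y' hyy'
  have ha : y a ≤ y' a := hyy' a
  have hcast : ((y a : ℤ) : ℝ) ≤ ((y' a : ℤ) : ℝ) := by
    rcases Int.units_eq_one_or (y a) with h1 | h1 <;> rcases Int.units_eq_one_or (y' a) with h2 | h2
    · simp [h1, h2]
    · exact absurd ha (by rw [h1, h2]; decide)
    · simp [h1, h2]
    · simp [h1, h2]
  dsimp only
  linarith

/-- Expectation of one up-spin indicator: `E((1+σ)/2) = (1 + ⟨σ⟩)/2` (total mass one). -/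
theorem ex_half_one_add {α : Type*} [Fintype α] {μ : α → ℝ} (hμ1 : ∑ x, μ x = 1) (s : α → ℝ) :
    ex μ (fun x => (1 + s x) / 2) = (1 + ex μ s) / 2 := by
  simp only [ex]
  rw [show (1 + ∑ x, μ x * s x) / 2 = ∑ x, (μ x * 1 + μ x * s x) / 2 by
    rw [← Finset.sum_div, Finset.sum_add_distrib, ← Finset.sum_mul, hμ1, one_mul]]
  exact Finset.sum_congr rfl fun x _ => by ring

/-- Expectation of a product of two up-spin indicators. -/
theorem ex_half_one_add_mul_two {α : Type*} [Fintype α] {μ : α → ℝ} (hμ1 : ∑ x, μ x = 1) (s t : α → ℝ) :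
    ex μ ((fun x => (1 + s x) / 2) * fun x => (1 + t x) / 2) =
      (1 + ex μ s + ex μ t + ex μ (s * t)) / 4 := by
  simp only [ex, Pi.mul_apply]
  rw [show (1 + ∑ x, μ x * s x + ∑ x, μ x * t x + ∑ x, μ x * (s x * t x)) / 4 =
      ∑ x, (μ x * 1 + μ x * s x + μ x * t x + μ x * (s x * t x)) / 4 by
    rw [← Finset.sum_div, Finset.sum_add_distrib, Finset.sum_add_distrib, Finset.sum_add_distrib,
      ← Finset.sum_mul, hμ1, one_mul]]
  exact Finset.sum_congr rfl fun x _ => by ring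

/-- Expectation of a product of three up-spin indicators. -/
theorem ex_half_one_add_mul_three {α : Type*} [Fintype α] {μ : α → ℝ} (hμ1 : ∑ x, μ x = 1)
    (s t u : α → ℝ) :
    ex μ ((fun x => (1 + s x) / 2) * (fun x => (1 + t x) / 2) * fun x => (1 + u x) / 2) =
      (1 + ex μ s + ex μ t + ex μ u + ex μ (s * t) + ex μ (s * u) + ex μ (t * u) + ex μ (s * t * u)) / 8 := by
  simp only [ex, Pi.mul_apply]
  rw [show (1 + ∑ x, μ x * s x + ∑ x, μ x * t x + ∑ x, μ x * u x + ∑ x, μ x * (s x * t x) +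
        ∑ x, μ x * (s x * u x) + ∑ x, μ x * (t x * u x) + ∑ x, μ x * (s x * t x * u x)) / 8 =
      ∑ x, (μ x * 1 + μ x * s x + μ x * t x + μ x * u x + μ x * (s x * t x) + μ x * (s x * u x) +
        μ x * (t x * u x) + μ x * (s x * t x * u x)) / 8 by
    rw [← Finset.sum_div, Finset.sum_add_distrib, Finset.sum_add_distrib, Finset.sum_add_distrib,
      Finset.sum_add_distrib, Finset.sum_add_distrib, Finset.sum_add_distrib, Finset.sum_add_distrib,
      ← Finset.sum_mul, hμ1, one_mul]]
  exact Finset.sum_congr rfl fun x _ => by ring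

/-- **Single-site `C₃` of the Ising ferromagnet, in spin correlations** (`β ≥ 0`, ANY field `h ∈ ℝ`, ANY
boundary condition, any sites `x, y, z`): Sahi's `E₃ ≥ 0` for the three up-spin indicators
`n_u = (1 + σ_u)/2`, multiplied by `8` and expanded,
`0 ≤ 2⟨σ_xσ_yσ_z⟩ + ⟨σ_xσ_y⟩ + ⟨σ_xσ_z⟩ + ⟨σ_yσ_z⟩ + ⟨σ_x⟩⟨σ_y⟩⟨σ_z⟩ − ⟨σ_x⟩⟨σ_yσ_z⟩ − ⟨σ_y⟩⟨σ_xσ_z⟩ − ⟨σ_z⟩⟨σ_xσ_y⟩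
   − ⟨σ_x⟩⟨σ_y⟩ − ⟨σ_x⟩⟨σ_z⟩ − ⟨σ_y⟩⟨σ_z⟩`,
equivalently `U₃(x,y,z) ≥ −½ Σ_cyc (1 + ⟨σ_x⟩)(⟨σ_yσ_z⟩ − ⟨σ_y⟩⟨σ_z⟩)` — a lower bound on the third Ursell
function complementary to the GHS upper bound `U₃ ≤ 0` (`isingExpect_ghs`). -/
theorem isingExpect_sahiC3_threeSites (Λ : Finset V) {β : ℝ} (hβ : 0 ≤ β) (h : ℝ)
    (bc : BoundaryCondition V) (x y z : V) :
    0 ≤ 2 * isingExpect Gr Λ β h bc (fun σ => spinAt x σ * spinAt y σ * spinAt z σ) +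
        isingExpect Gr Λ β h bc (fun σ => spinAt x σ * spinAt y σ) +
        isingExpect Gr Λ β h bc (fun σ => spinAt x σ * spinAt z σ) +
        isingExpect Gr Λ β h bc (fun σ => spinAt y σ * spinAt z σ) +
        isingExpect Gr Λ β h bc (spinAt x) * isingExpect Gr Λ β h bc (spinAt y) *
          isingExpect Gr Λ β h bc (spinAt z) -
        isingExpect Gr Λ β h bc (spinAt x) * isingExpect Gr Λ β h bc (fun σ => spinAt y σ * spinAt z σ) -
        isingExpect Gr Λ β h bc (spinAt y) * isingExpect Gr Λ β h bc (fun σ => spinAt x σ * spinAt z σ) -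
        isingExpect Gr Λ β h bc (spinAt z) * isingExpect Gr Λ β h bc (fun σ => spinAt x σ * spinAt y σ) -
        isingExpect Gr Λ β h bc (spinAt x) * isingExpect Gr Λ β h bc (spinAt y) -
        isingExpect Gr Λ β h bc (spinAt x) * isingExpect Gr Λ β h bc (spinAt z) -
        isingExpect Gr Λ β h bc (spinAt y) * isingExpect Gr Λ β h bc (spinAt z) := by
  -- the normalised Gibbs weight and the three spins as functions of `τ : Λ → ℤˣ`
  set μ : (Λ → ℤˣ) → ℝ := fun τ => isingWeight Gr Λ β h bc τ / isingPartitionFunction Gr Λ β h bc with hμ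
  have hFKG : IsFKGMeasure μ := isFKGMeasure_isingGibbsWeight Gr Λ hβ h bc
  set v : Fin 3 → V := ![x, y, z] with hv
  set s : Fin 3 → (Λ → ℤˣ) → ℝ := fun a τ => spinAt (v a) (glue Λ τ bc) with hs
  -- Sahi's `C₃` for the three up-spin indicators
  have key := ising_sahiE_threeSites_nonneg Gr Λ hβ h bc v 3
    (fun a w => (1 + ((w a : ℤ) : ℝ)) / 2) (fun a w => half_one_add_units_nonneg (w a))
    (fun a => monotone_half_one_add_apply a)
  have hfun : (fun (i : Fin 3) (τ : Λ → ℤˣ) => (1 + (((glue Λ τ bc (v i) : ℤˣ) : ℤ) : ℝ)) / 2) =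
      fun i => fun τ => (1 + s i τ) / 2 := by
    funext i τ
    simp only [hs, spinAt]
  rw [hfun, sahiE_three_apply] at key
  rw [ex_half_one_add_mul_three hFKG.sum_eq_one, ex_half_one_add_mul_two hFKG.sum_eq_one,
    ex_half_one_add_mul_two hFKG.sum_eq_one, ex_half_one_add_mul_two hFKG.sum_eq_one,
    ex_half_one_add hFKG.sum_eq_one, ex_half_one_add hFKG.sum_eq_one,
    ex_half_one_add hFKG.sum_eq_one] at key
  -- the moments are the Ising expectations
  have mx := measurable_spinAt (V := V) x
  have my := measurable_spinAt (V := V) y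
  have mz := measurable_spinAt (V := V) z
  have e0 : ex μ (s 0) = isingExpect Gr Λ β h bc (spinAt x) :=
    ex_isingGibbsWeight_comp_glue Gr Λ β h bc mx
  have e1 : ex μ (s 1) = isingExpect Gr Λ β h bc (spinAt y) :=
    ex_isingGibbsWeight_comp_glue Gr Λ β h bc my
  have e2 : ex μ (s 2) = isingExpect Gr Λ β h bc (spinAt z) :=
    ex_isingGibbsWeight_comp_glue Gr Λ β h bc mz
  have e01 : ex μ (s 0 * s 1) = isingExpect Gr Λ β h bc (fun σ => spinAt x σ * spinAt y σ) :=
    ex_isingGibbsWeight_comp_glue Gr Λ β h bc (mx.mul my)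
  have e02 : ex μ (s 0 * s 2) = isingExpect Gr Λ β h bc (fun σ => spinAt x σ * spinAt z σ) :=
    ex_isingGibbsWeight_comp_glue Gr Λ β h bc (mx.mul mz)
  have e12 : ex μ (s 1 * s 2) = isingExpect Gr Λ β h bc (fun σ => spinAt y σ * spinAt z σ) :=
    ex_isingGibbsWeight_comp_glue Gr Λ β h bc (my.mul mz)
  have e012 : ex μ (s 0 * s 1 * s 2) =
      isingExpect Gr Λ β h bc (fun σ => spinAt x σ * spinAt y σ * spinAt z σ) :=
    ex_isingGibbsWeight_comp_glue Gr Λ β h bc ((mx.mul my).mul mz)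
  rw [e0, e1, e2, e01, e02, e12, e012] at key
  nlinarith [key]

end Ising

end Summit.CriticalPhenomena.PercolationContinuityZ3.Theorems.SahiThreeCoordinates
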